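import Literature.NumberTheory.GaloisRepresentations.WeakAbelianDirectSummand
import Literature.NumberTheory.GaloisRepresentations.FrobeniusDensityOneProofs
import Literature.NumberTheory.GaloisRepresentations.ArtinRestriction
import HarnessLib

/-!
# Weak abelian direct summands: stability under restriction to a finite extension (proofs)

Topic `NumberTheory/GaloisRepresentations`; namespace
`Literature.NumberTheory.GaloisRepresentations`.  A *proofs* file (theorems only; no definition,
no named fact), sibling of `WeakAbelianDirectSummand.lean` (Böckle–Hui 2025, Def. 2.3
`FramedGaloisRep.WeaklyDivides`; the named fact `exists_heckeCharacter_of_weaklyDivides` =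
Thm. 1.1).

The first step of the printed proof of Theorem 1.1 (BH §2.7: "For any finite field extension
`L/K`, the restriction `ρ_ℓ|_{Gal_L}` is also `E`-rational. Since the local algebraicity of `ψ_ℓ`
follows from the local algebraicity of `ψ_ℓ|_{Gal_L}`, we may assume that the algebraic monodromy
group `G_ℓ` is connected by replacing `K` by some finite extension") uses tacitly that the weak
divisibility `ψ ∣_w ρ` survives the restriction.  For a character `ψ` this is proved here:

* `hasDirichletDensity_zero_of_forall_under_mem`, `hasDirichletDensity_zero_setOf_under_mem`,
  `hasDirichletDensity_one_setOf_under_mem` —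
  **density one lifts along a finite extension** `K ⊆ L`: if `𝓛` has Dirichlet density one among
  the places of `K`, then `{w : w ∩ K ∈ 𝓛}` has Dirichlet density one among the places of `L`
  (the degree-one places carry the density; counting step
  `primeNormCount_le_mul_primeNormCount_of_forall_under_mem` of `FrobeniusDensityOneProofs.lean`).
* `det_scalar_pow_sub_pow_eq_zero_of_det_scalar_sub_eq_zero` — if `a` is an eigenvalue of `M`
  (`det (a - M) = 0`) then `aᵏ` is an eigenvalue of `Mᵏ`.
* **`FramedGaloisRep.WeaklyDivides.restrictField`** — for a character `ψ : Γ_K →ₜ* GL_1(A)` weakly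
  dividing `ρ : Γ_K →ₜ* GL_n(A)`, the restriction `ψ|_{Γ_L}` weakly divides `ρ|_{Γ_L}` for every
  finite extension `L/K` of number fields: over `w ∣ v`, `v ∈ 𝓛`, both restrictions are unramified
  (`FramedGaloisRep.isUnramifiedAt_restrictField`) and an arithmetic Frobenius `τ` at `𝔔 ∣ w`
  restricts to `Frob_𝔓^{f(w|v)}` modulo inertia (`exists_primesAbove_restrict`), so
  `ψ|_L(τ) = ψ(φ)^f`, `ρ|_L(τ) = ρ(φ)^f`, and `ψ(φ)` an eigenvalue of `ρ(φ)` gives `ψ(φ)^f` an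
  eigenvalue of `ρ(φ)^f`.

## References

* G. Böckle, C.-Y. Hui, Math. Ann. 393 (2025), Def. 2.3 and §2.7 (proof of Thm. 1.1, first
  reduction). [BockleHui2025]
* J. Neukirch, *Algebraic Number Theory* (1999), Ch. I §9, VII §13. [NeukirchANT1999]
-/

noncomputable section

open NumberField IsDedekindDomain Filter Topology Polynomial
open scoped Classical

namespace Literature.NumberTheory.GaloisRepresentations

open Literature.NumberTheory.LFunctions Literature.NumberTheory.LFunctions.NumberField

/-! ### Density one lifts along a finite extension -/

section Density

variable {F : Type*} [Field F] [NumberField F] {M : Type*} [Field M] [NumberField M] [Algebra F M]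

/-- **A set of places of `M` lying (in degree one) over a density-zero set of places of `F` has
density zero** (among the places of `M`): if every `w ∈ X` of prime absolute norm has
`w ∩ F ∈ Z` with `d(Z) = 0`, then `d(X) = 0`.  Writing `Σ_{w ∈ X} Nw^{-s}` as its degree-one part
plus a bounded rest (`tsum_indicator_absNorm_eq_primeSeries_add`,
`exists_bound_tsum_not_prime_absNorm`), the degree-one part is
`≤ 2^{[M:ℚ]} Σ_{v ∈ Z} Nv^{-s} = o(log (1/(s-1)))`
(`primeNormCount_le_mul_primeNormCount_of_forall_under_mem`,
`tendsto_tsum_indicator_div_log_zero`), while `Σ_w Nw^{-s} ∼ log (1/(s-1))`. [folklore] -/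
theorem hasDirichletDensity_zero_of_forall_under_mem {X : Set (HeightOneSpectrum (𝓞 M))}
    {Z : Set (HeightOneSpectrum (𝓞 F))}
    (H : ∀ w ∈ X, (Ideal.absNorm w.asIdeal).Prime → w.under (𝓞 F) ∈ Z)
    (hZ : HasDirichletDensity F Z 0) : HasDirichletDensity M X 0 := by
  set d : ℝ := (2 : ℝ) ^ Module.finrank ℚ M with hd
  have hd0 : 0 ≤ d := pow_nonneg zero_le_two _
  obtain ⟨B, hB⟩ := exists_bound_tsum_not_prime_absNorm (K := M)
  have hℓ := PrimeSum.tendsto_log_one_div_sub_one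
  -- (1) the numerator over `log (1/(s-1))` tends to `0`
  have hZlog := tendsto_tsum_indicator_div_log_zero hZ
  have hnum : Tendsto (fun s : ℝ => (∑' w : HeightOneSpectrum (𝓞 M),
      if w ∈ X then (Ideal.absNorm w.asIdeal : ℝ) ^ (-s) else 0) / Real.log (1 / (s - 1)))
      (𝓝[>] (1 : ℝ)) (𝓝 0) := by
    have hup : Tendsto (fun s : ℝ => d * ((∑' v : HeightOneSpectrum (𝓞 F),
        if v ∈ Z then (Ideal.absNorm v.asIdeal : ℝ) ^ (-s) else 0) / Real.log (1 / (s - 1))) +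
        B / Real.log (1 / (s - 1))) (𝓝[>] (1 : ℝ)) (𝓝 (d * 0 + 0)) :=
      (hZlog.const_mul d).add (tendsto_const_nhds.div_atTop hℓ)
    rw [mul_zero, add_zero] at hup
    refine tendsto_of_tendsto_of_tendsto_of_le_of_le' tendsto_const_nhds hup ?_ ?_
    · filter_upwards [PrimeSum.eventually_log_pos] with s hlog
      exact div_nonneg (tsum_indicator_nonneg X s) hlog.le
    · filter_upwards [PrimeSum.eventually_log_pos, PrimeSum.eventually_one_lt] with s hlog hs
      rw [mul_div_assoc', ← add_div]
      refine div_le_div_of_nonneg_right ?_ hlog.le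
      rw [tsum_indicator_absNorm_eq_primeSeries_add X hs]
      refine add_le_add ?_ ?_
      · -- degree-one part
        calc primeSeries (fun p => (primeNormCount M X p : ℝ)) s
            ≤ primeSeries (fun p => d * (primeNormCount F Z p : ℝ)) s := by
              refine primeSeries_mono (abs_primeNormCount_le X)
                (Bg := d * (2 : ℝ) ^ Module.finrank ℚ F) (fun p => ?_)
                (fun p => primeNormCount_le_mul_primeNormCount_of_forall_under_mem H p) hs
              rw [abs_mul, abs_of_nonneg hd0]
              exact mul_le_mul_of_nonneg_left (abs_primeNormCount_le _ p) hd0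
          _ = d * primeSeries (fun p => (primeNormCount F Z p : ℝ)) s := by
              rw [primeSeries_def, primeSeries_def, ← tsum_mul_left]
              exact tsum_congr fun p => by ring
          _ ≤ d * ∑' v : HeightOneSpectrum (𝓞 F),
                if v ∈ Z then (Ideal.absNorm v.asIdeal : ℝ) ^ (-s) else 0 := by
              refine mul_le_mul_of_nonneg_left ?_ hd0
              rw [← tsum_prime_absNorm_eq_primeSeries Z hs]
              refine (summable_indicator_absNorm_rpow_neg _ hs).tsum_le_tsum (fun v => ?_)
                (summable_indicator_absNorm_rpow_neg _ hs)
              split_ifs with h1 h2 h2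
              · exact le_rfl
              · exact absurd h1.1 h2
              · exact absNorm_rpow_neg_nonneg v s
              · exact le_rfl
      · -- degree `≥ 2` part
        refine le_trans ?_ (hB s hs)
        refine (summable_indicator_absNorm_rpow_neg _ hs).tsum_le_tsum (fun w => ?_)
          (summable_indicator_absNorm_rpow_neg _ hs)
        by_cases h1 : w ∈ X ∧ ¬ (Ideal.absNorm w.asIdeal).Prime
        · rw [if_pos h1, if_pos h1.2]
        · rw [if_neg h1]
          split_ifs
          · exact le_rfl
          · exact absNorm_rpow_neg_nonneg w s
  -- (2) the denominator over `log (1/(s-1))` tends to `1`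
  have hden := tendsto_tsum_indicator_absNorm_div_log (hasStrongDirichletDensity_univ M)
  simp only [Set.mem_univ, if_true] at hden
  -- (3) the ratio
  have h := hnum.div hden one_ne_zero
  rw [zero_div] at h
  refine h.congr' ?_
  filter_upwards [PrimeSum.eventually_log_pos] with s hlog
  rw [Pi.div_apply, div_div_div_cancel_right₀ hlog.ne']

/-- **The places of `M` over a density-zero set of places of `F` have density zero.** [folklore] -/
theorem hasDirichletDensity_zero_setOf_under_mem {Z : Set (HeightOneSpectrum (𝓞 F))}
    (hZ : HasDirichletDensity F Z 0) :
    HasDirichletDensity M {w : HeightOneSpectrum (𝓞 M) | w.under (𝓞 F) ∈ Z} 0 :=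
  hasDirichletDensity_zero_of_forall_under_mem (M := M)
    (X := {w : HeightOneSpectrum (𝓞 M) | w.under (𝓞 F) ∈ Z}) (Z := Z) (fun _ hw _ => hw) hZ

/-- **Density one lifts along a finite extension**: if `𝓛` has Dirichlet density one among the
finite places of `F`, then the set of places of `M ⊇ F` lying over `𝓛` has Dirichlet density
one. [folklore] -/
theorem hasDirichletDensity_one_setOf_under_mem {𝓛 : Set (HeightOneSpectrum (𝓞 F))}
    (h𝓛 : HasDirichletDensity F 𝓛 1) :
    HasDirichletDensity M {w : HeightOneSpectrum (𝓞 M) | w.under (𝓞 F) ∈ 𝓛} 1 := by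
  have hZ : HasDirichletDensity F 𝓛ᶜ 0 := by
    have := h𝓛.compl
    rwa [sub_self] at this
  have h0 := (hasDirichletDensity_zero_setOf_under_mem (M := M) hZ).compl
  rw [sub_zero] at h0
  refine h0.congr_set (Set.ext fun w => ?_)
  simp only [Set.mem_compl_iff, Set.mem_setOf_eq, not_not]

end Density

/-! ### Eigenvalues of powers -/

/-- If `a` is an eigenvalue of `M`, i.e. `det (a·1 - M) = 0`, then `aᵏ` is an eigenvalue of
`Mᵏ`: `a·1 - M` divides `aᵏ·1 - Mᵏ` (they commute). [folklore] -/
theorem det_scalar_pow_sub_pow_eq_zero_of_det_scalar_sub_eq_zero {R : Type*} [CommRing R]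
    {m : Type*} [Fintype m] [DecidableEq m] {a : R} {M : Matrix m m R}
    (h : (Matrix.scalar m a - M).det = 0) (k : ℕ) :
    (Matrix.scalar m (a ^ k) - M ^ k).det = 0 := by
  rw [map_pow]
  obtain ⟨S, hS⟩ := (Matrix.scalar_commute a (fun r => Commute.all a r) M).sub_dvd_pow_sub_pow k
  rw [hS, Matrix.det_mul, h, zero_mul]

/-! ### Weak divisibility survives restriction to a finite extension -/

namespace FramedGaloisRep

variable {K : Type*} [Field K] [NumberField K] {L : Type*} [Field L] [NumberField L]
  [Algebra K L] {A : Type*} [CommRing A] [TopologicalSpace A] {n : ℕ}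

/-- For a character `ψ`, `charpoly ψ(σ) ∣ charpoly ρ(σ)` iff `det (ψ(σ)₀₀·1 - ρ(σ)) = 0`
(`charpoly ψ(σ) = X - ψ(σ)₀₀`, `Polynomial.dvd_iff_isRoot`, `Matrix.eval_charpoly`). [folklore] -/
theorem charpoly_dvd_charpoly_iff_det_eq_zero {F' : Type*} [Field F']
    (ψ : FramedGaloisRep F' A 1) (ρ : FramedGaloisRep F' A n) (σ : Field.absoluteGaloisGroup F') :
    FramedRep.charpoly ψ σ ∣ FramedRep.charpoly ρ σ ↔
      (Matrix.scalar (Fin n) (((ψ σ : GL (Fin 1) A) : Matrix (Fin 1) (Fin 1) A) 0 0) -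
        ((ρ σ : GL (Fin n) A) : Matrix (Fin n) (Fin n) A)).det = 0 := by
  rw [charpoly_eq_X_sub_C_det, dvd_iff_isRoot, IsRoot.def, FramedRep.charpoly, Matrix.eval_charpoly,
    Matrix.GeneralLinearGroup.val_det_apply, Matrix.det_fin_one]

/-- **Weak divisibility survives restriction** (the tacit first step of BH §2.7).  Let
`ψ : Γ_K →ₜ* GL_1(A)` be a character weakly dividing `ρ : Γ_K →ₜ* GL_n(A)` and `L/K` a finite
extension of number fields.  Then `ψ|_{Γ_L}` weakly divides `ρ|_{Γ_L}`: the places `w` of `L` over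
the density-one set `𝓛` of Def. 2.3 form a set of density one
(`hasDirichletDensity_one_setOf_under_mem`); at such `w ∣ v` both restrictions are unramified
(`isUnramifiedAt_restrictField`), and for an arithmetic Frobenius `τ` at a prime `𝔔 ∣ w` of
`\bar ℤ_L` there are a prime `𝔓 ∣ v` of `\bar ℤ_K` and an arithmetic Frobenius `φ` at `𝔓` with
`res(τ) ≡ φ^{f(w|v)}` modulo `I_𝔓` (`exists_primesAbove_restrict`), so `ψ|_L(τ) = ψ(φ)^f` and
`ρ|_L(τ) = ρ(φ)^f`; as `ψ(φ)` is an eigenvalue of `ρ(φ)`, `ψ(φ)^f` is one of `ρ(φ)^f`.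
[cite: BockleHui2025, §2.7 (proof of Theorem 1.1, first reduction) with Definition 2.3] -/
theorem WeaklyDivides.restrictField {K : Type*} [Field K] [NumberField K] (L : Type*) [Field L]
    [NumberField L] [Algebra K L] {ψ : FramedGaloisRep K A 1} {ρ : FramedGaloisRep K A n}
    (h : ψ.WeaklyDivides ρ) : (ψ.restrictField L).WeaklyDivides (ρ.restrictField L) := by
  obtain ⟨𝓛, h𝓛, hdiv⟩ := h
  refine ⟨{w | w.under (𝓞 K) ∈ 𝓛}, hasDirichletDensity_one_setOf_under_mem h𝓛, fun w hw => ?_⟩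
  have hwv : w.asIdeal.under (𝓞 K) = (w.under (𝓞 K)).asIdeal := rfl
  obtain ⟨hρ, hψ, hd⟩ := hdiv _ hw
  refine ⟨ρ.isUnramifiedAt_restrictField hwv hρ, ψ.isUnramifiedAt_restrictField hwv hψ,
    fun 𝔔 h𝔔 τ hτ => ?_⟩
  -- the prime `𝔓 ∣ v` below `𝔔` and a Frobenius `φ` there
  obtain ⟨𝔓, h𝔓, -, hFr⟩ := exists_primesAbove_restrict K L hwv h𝔔
  obtain ⟨φ, hφ⟩ := HeightOneSpectrum.exists_isArithFrobAt_of_mem_primesAbove_holds h𝔓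
  set f := w.asIdeal.inertiaDeg (𝓞 K) with hf
  have hrel := hFr τ hτ φ hφ
  have hρτ : (ρ.restrictField L) τ = ρ φ ^ f := by
    have h1 := hρ 𝔓 h𝔓 _ hrel
    rw [map_mul, map_inv, mul_inv_eq_one] at h1
    rw [FramedGaloisRep.restrictField_apply, h1, map_pow]
  have hψτ : (ψ.restrictField L) τ = ψ φ ^ f := by
    have h1 := hψ 𝔓 h𝔓 _ hrel
    rw [map_mul, map_inv, mul_inv_eq_one] at h1
    rw [FramedGaloisRep.restrictField_apply, h1, map_pow]
  -- eigenvalue of the power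
  have hφdvd := hd 𝔓 h𝔓 φ hφ
  rw [charpoly_dvd_charpoly_iff_det_eq_zero] at hφdvd ⊢
  have ha : (((ψ.restrictField L) τ : GL (Fin 1) A) : Matrix (Fin 1) (Fin 1) A) 0 0 =
      ((((ψ φ : GL (Fin 1) A) : Matrix (Fin 1) (Fin 1) A) 0 0)) ^ f := by
    rw [hψτ, Units.val_pow_eq_pow_val]
    have hdet := Matrix.det_fin_one (((ψ φ : GL (Fin 1) A) : Matrix (Fin 1) (Fin 1) A) ^ f)
    rw [← hdet, Matrix.det_pow, Matrix.det_fin_one]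
  have hM : (((ρ.restrictField L) τ : GL (Fin n) A) : Matrix (Fin n) (Fin n) A) =
      ((ρ φ : GL (Fin n) A) : Matrix (Fin n) (Fin n) A) ^ f := by
    rw [hρτ, Units.val_pow_eq_pow_val]
  rw [ha, hM]
  exact det_scalar_pow_sub_pow_eq_zero_of_det_scalar_sub_eq_zero hφdvd f

end FramedGaloisRep

end Literature.NumberTheory.GaloisRepresentations
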